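import Summits.QuantumFields.YangMills.Theorems.UnitScaleTiltProp7SectET3HessFormExplicitT3
import Summits.QuantumFields.YangMills.Theorems.UnitScaleTiltProp7SectET3Objects
import Literature.MathematicalPhysics.QuantumFieldTheory.Balaban1983to89.B9Eq31ActionZpow
import Literature.MathematicalPhysics.QuantumFieldTheory.Balaban1983to89.B11Eq90V0primeCurrent
import Literature.MathematicalPhysics.QuantumFieldTheory.Balaban1983to89.B11Eq111FrakG
import HarnessLib

/-!
# Route `UnitScaleTilt`, crux «MinimiserStabilityRegPr» (stmt-QuantumFields-19200, stub EX `stub_existenceMinimalOrbit`, route (α)) — «SECT-C-84 (act)»: **THE LATTICE ∕ UNITS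
# TRANSPORT OF THE WILSON ACTION** between lit-balaban's integer-power action `actionZ Tsh η 3 τ₂` on the `TSite` lattice at the background of record `bgOfCfg F K U₀` (the carrier of
# `Jcur`, `W80`, `V80Z`, and of lit `B11Eq81ExpansionZpow.hasDerivAt_actionZ_chartRay_real`) and brick L0b's `actionRe F K (chartU F K U₀ ·)` on the route lattice (the carrier of the EX
# display's ray `wilsonAction4 ∘ emb15 ∘ expHermField`): `actionZ Tsh η 3 τ₂ (prodCfg (Ucur (bgOfCfg U₀)) η (curL (flat115 Y))) = η⁻¹ · 2 · actionRe (chartU U₀ (κ_f • ιY))`, `κ_f = η·i`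

Cell `ym3-torus` (HUMAN RULING D-0037, YM ladder rung R3 — YM₃ on T³, NOT d = 4, NOT Clay; YM gap NOT proved), width seat `ym3-torus-px21` gen 2 (explicit-unit helper; lineage `hCrit93′`:
✓`Prop7Crit127OfCrit93Split`, ✓`Prop7Crit127Split127AtZero`; signed «CRIT93-OF-84» `Prop7Crit93OfEq111`, «ACTIONGRAD-JCUR» `Prop7ActionGradCurrent`; LOCATE `LOCATE-SECT-C-84-px21g2.md` (act)).
THEOREMS ONLY (0 `def`, 0 `sorry`); `--supports stmt-QuantumFields-19200 --as helper`, count-neutral; NO claim on crux ∕ stub ∕ registry.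

THE PRINT.  [Balaban1985BackgroundPropagators] (3.1) p. 390: «A^η(U) = Σ_{p⊂T_η} η^{d−4}(1 − Re tr U(∂p))», p. 390 «U = U′U₀», (3.5)–(3.6) p. 391; [Balaban1987RG1] (0.2) p. 252 (the route's `wilsonAction4`, weight 1);
[Balaban1985Variational] (5) p. 278, (112) p. 294 `U₁ = exp iη[A′ − HD(A′)]`.  At d = 3 the printed weight is `η^{d−4} = η⁻¹` (lit ✓`B9Eq31ActionZpow.actionZ_three`).

WHAT IS PROVED (member `F`, `K n`; `U₀ : GaugeField (F.P K) 0 SU(2)`; `η := L^{−(K−n)}`; `τ₂ := tr` on `M₂(ℂ)`; ns `…Theorems.Prop7ActionLatticeTransport`):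
* §1 ★`plaqU_Tsh_cfgEquiv` — for ANY units field `V` on the route bonds, lit's plaquette variable of its `TSite` reading `Ucur (cfgEquiv F K _ V)` at `siteEquiv x` IS the route-lattice one
  (`plaqU (torusT (F.P K) 0) (fun μ x ↦ V ⟨x, μ⟩)`); ★`sum_posPlaq_siteEquiv` (re-indexing `posPlaq (TSite …) ↔ posPlaq (Site …)`); `wil_trace_eq_two_mul_wil_halfTrace` (`wil tr = 2·wil ½tr`).
* §2 ★★`actionZ_Tsh_cfgEquiv_eq` — `actionZ Tsh η 3 τ₂ (Ucur (cfgEquiv F K _ V)) = η⁻¹ · (2 · actionRe F K V)` for ANY `V` (✓px5 `actionRe_eq_sum_wil`, ✓`sum_plaq_eq_sum_posPlaq`).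
* §3 ★★`prodCfg_Ucur_bgOfCfg_eq` — lit's product configuration (3.5) `U′U₀`, `U′ = exp(iη·Y♭)`, on the `TSite` lattice IS the `TSite` reading of brick L0b's chart configuration
  `chartU U₀ (κ_f • ιY)` (`κ_f = (η:ℂ)·I`, `ιY := (JetSup.equiv Y) ∘ bondEquiv` — the (W-X′) letters of ★w2-19200 g6 19:50:28Z); ★★★`actionZ_chartCfg_eq_actionRe` — THE TRANSPORT:
  `actionZ Tsh η 3 τ₂ (prodCfg (Ucur (bgOfCfg F K U₀)) η (curL (flat115 Y))) = η⁻¹ · (2 · actionRe F K (chartU F K U₀ (κ_f • ιY)))` for every (115)-field `Y`.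
HONEST SCOPE.  Index and units bookkeeping over landed letters; exact background; no estimate; not a proof of any stub; nothing continuum ∕ OS ∕ mass-gap ∕ Clay.

References: T. Bałaban, CMP **99** (1985) 389–434 [Balaban1985BackgroundPropagators] ((3.1) p.390, (3.5)–(3.6) p.391); CMP **102** (1985) 277–309 [Balaban1985Variational] ((5) p.278,
(112) p.294); CMP **109** (1987) 249–301 [Balaban1987RG1] ((0.2) p.252).
-/

set_option autoImplicit false

noncomputable section

open scoped Matrix.Norms.L2Operator BigOperators
open Complex (I)

namespace Summit.QuantumFields.YangMills.Theorems.Prop7ActionLatticeTransport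

open Literature.MathematicalPhysics.QuantumFieldTheory.Balaban1983to89
open Literature.MathematicalPhysics.QuantumFieldTheory.Balaban1983to89.T3ContinuumYM3Torus
open NormedSpace (exp)
open B4Sect5Torus (TSite)
open B9SectCLatticeCarrier (Bond)
open B9TorusCalculus (torusT)
open B9Eq37Insertion (wil reC holU val_holU)
open B9Eq39Adjoint (plaqU posPlaq mem_posPlaq prodCfg fluct)
open B9Eq31ActionZpow (actionZ actionZ_three)
open B11Eq90V0primeCurrent (Tsh Ucur curL curL_apply flat115 flat115_apply)
open B11Eq115Space (Space115 JetSup)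
open B11Eq111FrakG (nabla115)
open B7Prop1Explicit (expUnit val_expUnit)
open Beta.TransportVertices (holonomy holonomy_cons holonomy_nil)
open T3SectALandauChart (bgUnits)
open Summit.QuantumFields.YangMills.Theorems.Prop7SectET3Transport (periodsT3 siteEquiv siteEquiv_shiftEquiv siteEquiv_shift bondEquiv cfgEquiv cfgEquiv_apply bgOfCfg bgOfCfg_eq)
open Summit.QuantumFields.YangMills.Theorems.Prop7SectET3WilsonHessian (chartU actionRe val_chartU)
open Summit.QuantumFields.YangMills.Theorems.Prop7SectET3ActionQuad (actionRe_eq_sum_wil halfTrace_apply')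
open Summit.QuantumFields.YangMills.Theorems.Prop7SectET3HessFormExplicit (sum_plaq_eq_sum_posPlaq)

variable {F : T3Family} {n K : ℕ}

/-! ## §1 Plaquettes, the re-indexing, and `tr` vs `½tr` -/

/-- ★ **PLAQUETTE VARIABLES AGREE ACROSS THE TWO LATTICE PRESENTATIONS**, for ANY units field `V` on the route bonds: lit's `U(∂p_{μν}(y))` of the `TSite` reading
`Ucur (cfgEquiv F K _ V)` at `y = siteEquiv x` is the route lattice's `plaqU (torusT (F.P K) 0) (fun μ x ↦ V ⟨x, μ⟩) μ ν x`. [cite: Balaban1985BackgroundPropagators, (3.1) p.390] -/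
theorem plaqU_Tsh_cfgEquiv (V : PBond (F.P K) 0 → (Matrix (Fin 2) (Fin 2) ℂ)ˣ) (μ ν : Fin 3) (x : Site (F.P K) 0) :
    plaqU Tsh (Ucur (cfgEquiv F K _ V)) μ ν (siteEquiv F K x) = plaqU (torusT (F.P K) 0) (fun μ x => V ⟨x, μ⟩) μ ν x := by
  have hT : ∀ (κ : Fin 3) (y : Site (F.P K) 0), Tsh κ (siteEquiv F K y) = siteEquiv F K (y.shift κ) :=
    fun κ y => (siteEquiv_shiftEquiv F K y κ).symm
  have hV : ∀ (κ : Fin 3) (y : Site (F.P K) 0), Ucur (cfgEquiv F K _ V) κ (siteEquiv F K y) = V ⟨y, κ⟩ := fun κ y => by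
    show cfgEquiv F K _ V (siteEquiv F K y, κ) = V ⟨y, κ⟩
    rw [cfgEquiv_apply, Prop7SectET3Transport.bondEquiv_symm_apply, Equiv.symm_apply_apply]
  rw [plaqU, plaqU, hV, hT, hV, hT, hV, hV]
  rfl

/-- ★ **RE-INDEXING THE POSITIVELY ORIENTED PLAQUETTES** along `siteEquiv F K : Site (F.P K) 0 ≃ TSite 3 (periodsT3 F K)`. [folklore] -/
theorem sum_posPlaq_siteEquiv {M : Type*} [AddCommMonoid M] (f : Fin 3 → Fin 3 → TSite 3 (periodsT3 F K) → M) :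
    ∑ q ∈ posPlaq (TSite 3 (periodsT3 F K)) (Fin 3), f q.2.1 q.2.2 q.1
      = ∑ q ∈ posPlaq (Site (F.P K) 0) (Fin (F.P K).d), f q.2.1 q.2.2 (siteEquiv F K q.1) := by
  refine Finset.sum_nbij' (fun q => ((siteEquiv F K).symm q.1, q.2)) (fun q => (siteEquiv F K q.1, q.2)) ?_ ?_ ?_ ?_ ?_
  · intro q hq
    rw [mem_posPlaq] at hq ⊢
    exact hq
  · intro q hq
    rw [mem_posPlaq] at hq ⊢
    exact hq
  · intro q _
    simp only [Equiv.apply_symm_apply]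
  · intro q _
    simp only [Equiv.symm_apply_apply]
  · intro q _
    simp only [Equiv.apply_symm_apply]

/-- `wil tr W = 2·wil (½tr) W` on `M₂(ℂ)` (`wil τ W = τ 1 − τ(½(W + W⁻¹))`). [folklore] -/
theorem wil_trace_eq_two_mul_wil_halfTrace (W : (Matrix (Fin 2) (Fin 2) ℂ)ˣ) :
    wil ((LinearMap.toContinuousLinearMap (Matrix.traceLinearMap (Fin 2) ℂ ℂ) : Matrix (Fin 2) (Fin 2) ℂ →L[ℂ] ℂ) : Matrix (Fin 2) (Fin 2) ℂ →ₗ[ℂ] ℂ) W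
      = 2 * wil (((2 : ℂ)⁻¹ • LinearMap.toContinuousLinearMap (Matrix.traceLinearMap (Fin 2) ℂ ℂ)) : Matrix (Fin 2) (Fin 2) ℂ →ₗ[ℂ] ℂ) W := by
  simp only [wil, LinearMap.coe_toContinuousLinearMap, LinearMap.smul_apply, Matrix.traceLinearMap_apply, smul_eq_mul]
  ring

/-! ## §2 The integer-power action of a `TSite` reading is `η⁻¹·2·actionRe` -/

/-- ★★ **`actionZ Tsh η 3 tr (Ucur (cfgEquiv F K _ V)) = η⁻¹·(2·actionRe F K V)`** for ANY units field `V` on the route bonds and any `η` (d = 3 weight `η^{d−4} = η⁻¹`,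
✓`actionZ_three`; ✓px5 `actionRe_eq_sum_wil`). [cite: Balaban1985BackgroundPropagators, (3.1) p.390; Balaban1987RG1, (0.2) p.252] -/
theorem actionZ_Tsh_cfgEquiv_eq (η : ℝ) (V : PBond (F.P K) 0 → (Matrix (Fin 2) (Fin 2) ℂ)ˣ) :
    actionZ Tsh η 3 ((LinearMap.toContinuousLinearMap (Matrix.traceLinearMap (Fin 2) ℂ ℂ) : Matrix (Fin 2) (Fin 2) ℂ →L[ℂ] ℂ) : Matrix (Fin 2) (Fin 2) ℂ →ₗ[ℂ] ℂ)
        (Ucur (cfgEquiv F K _ V))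
      = ((η : ℂ))⁻¹ * (2 * actionRe F K V) := by
  rw [actionZ_three, ← Finset.mul_sum,
    sum_posPlaq_siteEquiv (fun μ ν y => wil ((LinearMap.toContinuousLinearMap (Matrix.traceLinearMap (Fin 2) ℂ ℂ) : Matrix (Fin 2) (Fin 2) ℂ →L[ℂ] ℂ) :
      Matrix (Fin 2) (Fin 2) ℂ →ₗ[ℂ] ℂ) (plaqU Tsh (Ucur (cfgEquiv F K _ V)) μ ν y))]
  congr 1
  rw [actionRe_eq_sum_wil, Finset.mul_sum, sum_plaq_eq_sum_posPlaq (fun x μ ν =>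
    2 * wil (((2 : ℂ)⁻¹ • LinearMap.toContinuousLinearMap (Matrix.traceLinearMap (Fin 2) ℂ ℂ)) : Matrix (Fin 2) (Fin 2) ℂ →ₗ[ℂ] ℂ)
      (plaqU (torusT (F.P K) 0) (fun μ x => V ⟨x, μ⟩) μ ν x))]
  refine Finset.sum_congr rfl fun q _ => ?_
  rw [plaqU_Tsh_cfgEquiv, wil_trace_eq_two_mul_wil_halfTrace]

/-! ## §3 Lit's product configuration on the `TSite` lattice IS the reading of brick L0b's chart configuration -/

/-- ★★ **`prodCfg (Ucur (bgOfCfg U₀)) η (curL (flat115 Y)) = Ucur (cfgEquiv (chartU U₀ (κ_f • ιY)))`**, `κ_f = (η:ℂ)·I`, `ιY = (JetSup.equiv Y) ∘ bondEquiv` — lit's `U′U₀` with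
`U′(b) = exp(iη·Y♭(b))` ((3.5), `B9Eq39Adjoint.prodCfg`) is the `TSite` reading of `(e^{X(b)}U₀(b))_b` at `X = κ_f • ιY` (the (W-X′) exponent).
[cite: Balaban1985BackgroundPropagators, p.390, (3.5)–(3.6) p.391; Balaban1985Variational, (112) p.294] -/
theorem prodCfg_Ucur_bgOfCfg_eq (U₀ : GaugeField (F.P K) 0 (Matrix.specialUnitaryGroup (Fin 2) ℂ)) (η : ℝ)
    {κ' : Type*} [Fintype κ'] {lev₀ : Bond 3 (periodsT3 F K) → ℕ} {lev₁ : κ' → ℕ} {L η' : ℝ} [Fact (0 < L)] [Fact (0 < η')]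
    {Dc : (Bond 3 (periodsT3 F K) → Matrix (Fin 2) (Fin 2) ℂ) →ₗ[ℂ] (κ' → Matrix (Fin 2) (Fin 2) ℂ)}
    (Y : Space115 L η' lev₀ lev₁ Dc) :
    prodCfg (Ucur (bgOfCfg F K U₀)) η (curL (flat115 Y))
      = Ucur (cfgEquiv F K _ (chartU F K U₀ ((((η : ℂ)) * I) • fun b : PBond (F.P K) 0 => JetSup.equiv _ _ _ Y (bondEquiv F K b)))) := by
  funext μ y
  ext1
  rw [prodCfg, fluct, Units.val_mul, val_holU, holonomy_cons, holonomy_nil, mul_one, Ucur, Ucur, cfgEquiv_apply, val_chartU, bgOfCfg_eq,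
    curL_apply, flat115_apply]
  simp only [Prop7SectET3Transport.bondEquiv_symm_apply, Prop7SectET3Transport.bondEquiv_apply, Pi.smul_apply, Equiv.apply_symm_apply, mul_comm I ((η : ℂ))]
  rfl

/-- ★★★ **THE TRANSPORT**: `actionZ Tsh η 3 tr (prodCfg (Ucur (bgOfCfg F K U₀)) η (curL (flat115 Y))) = η⁻¹ · (2 · actionRe F K (chartU F K U₀ (κ_f • ιY)))` — the function lit
`B11Eq81ExpansionZpow.hasDerivAt_actionZ_chartRay_real` differentiates (at `Y := T47 … (A′ + tδ′)`) IS, up to the constant `2η⁻¹`, brick L0b's complexified action at the EX display's chart point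
(whose real part is the route's `wilsonAction4` there, ✓`wilsonAction4_emb15_eq_re`). [cite: Balaban1985BackgroundPropagators, (3.1) p.390, (3.6) p.391; Balaban1985Variational, (5) p.278, (112) p.294] -/
theorem actionZ_chartCfg_eq_actionRe (U₀ : GaugeField (F.P K) 0 (Matrix.specialUnitaryGroup (Fin 2) ℂ)) (η : ℝ)
    {κ' : Type*} [Fintype κ'] {lev₀ : Bond 3 (periodsT3 F K) → ℕ} {lev₁ : κ' → ℕ} {L η' : ℝ} [Fact (0 < L)] [Fact (0 < η')]
    {Dc : (Bond 3 (periodsT3 F K) → Matrix (Fin 2) (Fin 2) ℂ) →ₗ[ℂ] (κ' → Matrix (Fin 2) (Fin 2) ℂ)}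
    (Y : Space115 L η' lev₀ lev₁ Dc) :
    actionZ Tsh η 3 ((LinearMap.toContinuousLinearMap (Matrix.traceLinearMap (Fin 2) ℂ ℂ) : Matrix (Fin 2) (Fin 2) ℂ →L[ℂ] ℂ) : Matrix (Fin 2) (Fin 2) ℂ →ₗ[ℂ] ℂ)
        (prodCfg (Ucur (bgOfCfg F K U₀)) η (curL (flat115 Y)))
      = ((η : ℂ))⁻¹ * (2 * actionRe F K (chartU F K U₀ ((((η : ℂ)) * I) • fun b : PBond (F.P K) 0 => JetSup.equiv _ _ _ Y (bondEquiv F K b)))) := by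
  rw [prodCfg_Ucur_bgOfCfg_eq, actionZ_Tsh_cfgEquiv_eq]

end Summit.QuantumFields.YangMills.Theorems.Prop7ActionLatticeTransport

end
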